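import Summits.QuantumFields.BalabanUV.T4Continuum.Support.NE9CurveSpeciesCoupling
import Summits.QuantumFields.BalabanUV.T4Continuum.Support.NE9RemainderSpeciesWitness

/-!
# NE9CurveSpeciesWitness — NON-VACUITY of the CURVE species' channel-side binder set BEYOND RAYS: a toy `CurData` with a
# genuinely NON-LINEAR slice curve meeting `CurData.Admissible`, the level counts, leaf A3's curve binders (c1)–(c3), crew row
# (w19)'s slice-curve regularity pair, analyticity and the (1.18)-type size — on which S4∕S5 (owner part 2) and A3-CUR FIRE — and
# which is NOT the curve reading `RemData.toCur` of ANY ray datum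
# (cell `pub-balaban`, T4-DAG §2 node U3 ∕ §6 NE9; NE9 formalisation swarm, unit `b2b-balaban-t4-ne9-formalise-leaf-06` gen 8,
# own-initiative micro-item «CUR-WITNESS», CLAIMS.log l.11008; `t4/formal/NE9/LEAVES.md` v1.7 §2 «an honest CURVE toy witness»)

HONEST FRAMING (T4-DAG PAGE 1).  Rung (B)+1 of the FINITE-VOLUME T⁴ programme — NOT infinite volume, NOT a mass gap, NOT the
Clay problem.  NE9 (`T4OutputRate.NE9` ∧ `FadingMemory`) is a cell NEW ESTIMATE, NOT PRINTED, NOT discharged here; spine 0/9;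
0/18 skeleton leaves instantiated on Bałaban's objects (O-NE9-1) — a TOY instantiates NO leaf.  HONEST DEPENDENCY (cell line,
verbatim): continuum YM on T⁴ ⇐ BetaPertH ∧ nine spine estimates (0/9 proved); BetaPertH ⇐ (D1) ∧ (D4) ∧ CAP+tail; G-an2-4 gates
asym, D1 and NE2/3/4.  `FlowStep.BetaPertH`, (B), (B^μ) do not occur.  Nothing of [I] = [Balaban1987RG1] ∕ [II] =
[Balaban1988RG2Cluster] is quoted as a hypothesis; the toy below is a CARICATURE (labelled so), not Bałaban's (1.23), not the
SU(2) curves σ′ ↦ U_j(□₀, exp i(B + σ′B))|_X of the LOCATED CORRECTION O-ne9p1g25-1.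

WHY.  The row owner's part 2 `NE9Lemma1CurveSpecies` (t4-ne9-p1 g25, p213869) re-typed the displayed species of [II] §1 with
analytic SLICE CURVES `D.cur … : ℂ → E` in place of rays, because [I] (3.34)∕(3.54) expand the old term along the analytic curve of
Lemma 4 (3.53) — a ray only for abelian G.  Every `CurData.Admissible` inhabitant exhibited so far is a RAY READING: leaf-09-g5's
REM-WITNESS `NE9RemainderSpeciesWitness` (p213736) re-points at `CurData` through `RemData.Admissible.toCur` (cur := σ′ • dir), and
the (w22) cross-read probes are not in the tree.  So the tree does not yet show that the curve binder set — `CurData.Admissible`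
(eleven fields: Lemma 4 TYPE analyticity + domain inclusion ON THE CONTOURS, `ϱ > 1`, the gain `ϱ⁻¹ ≤ c_dir·ℓ`, radii, source
discipline, G1), the level counts, leaf A3's curve binders (c1) joint continuity ∕ (c2) coupling-Lipschitz on the inner disc ∕
(c3) room (`NE9CurveSpeciesCoupling`, leaf-05-g5 p214647), crew row (w19)'s regularity pair `hcurA` (analytic + inside the ball
EVERYWHERE) ∕ `hcurC` (joint continuity on the unit slice circle) (`NE9Lemma1CurveSpeciesAdditive`, leaf-08-g4, at the gate),
and the family's analyticity + (1.18)-type size — is satisfiable by a slice curve that is NOT linear in the slice variable.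
THIS FILE exhibits such a datum, applies the landed curve producers to it BY NAME, and PROVES that it is not the curve reading of
any ray datum — so the located correction's extra generality is inhabited and carries no hidden contradiction in the typing.

THE TOY (labelled toy).  Carriers `T4HistoryLipschitzRecursion.toyCarriers` doubled; configuration space ℂ.  Datum `wCur γ`: the
index frame, `κ₁ = 1`, `d_k(Y) ≡ 0`, the one cube and `R ≡ 1` of REM-WITNESS's `wRem γ` (same level counts);
`r_k = 1∕16`; slice radius `ϱ ≡ 4`; SLICE CURVE `wCurve γ k s … t s′ σ′ τ := clamp_{1∕16}(t) · clamp_γ(s k) · (τ + τ²∕2)` — the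
SECOND-ORDER TAYLOR CARICATURE of the group-law curve σ′ ↦ exp(σ′B) − 1 (linear in the contour variable ON the contour and in
the k-th coupling ON the window, as REM-WITNESS's direction; QUADRATIC in the slice variable).  Letters `ℓ ≡ 1`, `c_dir = 1∕4`
(so `ϱ⁻¹ = c_dir·ℓ` and A3's inner disc `|τ| < (2c_dirℓ)⁻¹` has radius 2), `d₀ = 0`, `clip = 1∕2`.  Family: REM-WITNESS's
`wE γ g U (j, re∕im) := clamp_γ(g j) · Re∕Im(U⁶)` on ‖U‖ < 1, BY NAME.  Arithmetic: |τ + τ²∕2| ≤ |τ| + |τ|²∕2 is < 12 on |τ| < 4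
(the curve stays in the ball of radius 3∕4 < 1 = R) and < 4 on |τ| < 2 (room ≤ 1∕4 ≤ R∕2; coupling displacement ≤ ¼|Δg_k| =
clip·(R∕2)·|Δg_k| by the 1-Lipschitz clamp).

WHAT IS PROVED (kernel; toy data are `def`s, statements `[folklore]`; 0 sorry, 0 `def … : Prop`).
§1 the slice polynomial and the curve: `norm_quad_le`, `norm_quad_lt`, `wCurve`, `norm_wCurve_le`, `differentiable_wCurve`,
   `continuous_wCurve_uncurry`, **`wCurve_not_linear`** (at t = 1∕16, s k = γ > 0 no A with `wCurve … τ = τ • A` for all τ).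
§2 the datum `wCur γ`; **`admissible_wCur`** (`(wCur γ).Admissible (fun _ _ => 1) (1∕4) 0`, 0 ≤ γ ≤ 1 —
   all eleven fields); `levelCountsG_wCur`; `wE_mem_analyticClass_cur`; the (w19) pair **`cur_analytic_wCur`** (= `hcurA`) and
   **`cur_jointContinuous_wCur`** (= `hcurC`) IN (w19)'s EXACT SHAPE; the A3-CUR binders (c1) `cur_contourContinuous_wCur`,
   (c2) `cur_couplingLipschitz_wCur`, (c3) `cur_room_wCur` IN p214647's EXACT SHAPE.
§3 THE PRODUCERS FIRE: **`sizeBinders_witness_cur`** (owner part 2's `structureBinders_cur` ∧ `channelSizeAtStepNN_cur` APPLIED —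
   S4 ∧ S5 for the toy channel on its analytic class); **`cpieceResponse_witness_cur`** (leaf-05-g5's `cpieceResponse_cur`
   APPLIED — an actual per-piece coupling-response inequality, qc = 64·½·γ); **`tcup_witness_cur`** (`channelCouplingModulus_cur`
   APPLIED — the END's `hTcup` clause for the toy channel with the explicit `qT = 64·½·γ·1·(1−ω)⁻¹`).
§4 NOT A RAY: **`toCur_ne_wCur`** — `Dd.toCur ≠ wCur γ` for EVERY ray datum `Dd` (0 < γ).
S3 (`ChannelAdditive`) for the toy is NOT asserted: it is crew row (w19)'s `sBinders_cur` fed with §2's pair once p214120 lands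
(one `exact`).  DISGUISE TEST: a toy datum; elementary real∕complex analysis; producers applied by name — not NE9, not an
instantiation, nothing of Bałaban's curves claimed.
-/

noncomputable section

namespace Summit.QuantumFields.BalabanUV.T4Continuum.NE9CurveSpeciesWitness

open scoped BigOperators
open Metric Set
open Literature.MathematicalPhysics.QuantumFieldTheory.Balaban1983to89
open Literature.MathematicalPhysics.QuantumFieldTheory.Balaban1983to89.T4OutputRate
open Literature.MathematicalPhysics.QuantumFieldTheory.Balaban1983to89.T4HistoryLipschitzRecursion
open Literature.MathematicalPhysics.QuantumFieldTheory.Balaban1983to89.T4HistoryLipschitzSegment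
open Summit.QuantumFields.BalabanUV.T4Continuum.NE9Lemma1Counting
open Summit.QuantumFields.BalabanUV.T4Continuum.NE9Lemma1Gain
open Summit.QuantumFields.BalabanUV.T4Continuum.NE9Lemma1PieceClass
open Summit.QuantumFields.BalabanUV.T4Continuum.NE9Lemma1RemainderSpecies
open Summit.QuantumFields.BalabanUV.T4Continuum.NE9Lemma1CurveSpecies
open Summit.QuantumFields.BalabanUV.T4Continuum.NE9ComplexEncoding (doubleCarriers)
open Summit.QuantumFields.BalabanUV.T4Continuum.NE9CurveSpeciesCoupling (cpieceResponse_cur channelCouplingModulus_cur)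
open Summit.QuantumFields.BalabanUV.T4Continuum.NE9RemainderSpeciesWitness

/-! ## §1 The slice polynomial and the toy slice curve -/

/-- `‖τ + τ²∕2‖ ≤ ‖τ‖ + ‖τ‖²∕2`. [folklore] -/
theorem norm_quad_le (τ : ℂ) : ‖τ + τ ^ 2 / 2‖ ≤ ‖τ‖ + ‖τ‖ ^ 2 / 2 := by
  have h2 : ‖τ ^ 2 / 2‖ = ‖τ‖ ^ 2 / 2 := by rw [norm_div, norm_pow]; norm_num
  rw [← h2]
  exact norm_add_le _ _

/-- On the disc `‖τ‖ < ρ`: `‖τ + τ²∕2‖ < ρ + ρ²∕2`. [folklore] -/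
theorem norm_quad_lt {τ : ℂ} {ρ : ℝ} (h : ‖τ‖ < ρ) : ‖τ + τ ^ 2 / 2‖ < ρ + ρ ^ 2 / 2 := by
  refine (norm_quad_le τ).trans_lt ?_
  have h2 : ‖τ‖ ^ 2 ≤ ρ ^ 2 := pow_le_pow_left₀ (norm_nonneg _) h.le 2
  linarith

/-- THE TOY SLICE CURVE (labelled toy): `clamp_{1∕16}(t) · clamp_γ(s k) · (τ + τ²∕2)` — the second-order Taylor caricature of
σ′ ↦ exp(σ′B) − 1; linear in the contour variable on `|t| = 1∕16` and in the k-th coupling on the window, QUADRATIC in the slice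
variable τ. [folklore] -/
def wCurve (γ : ℝ) :
    ℕ → (ℕ → ℝ) → Unit → Unit → Unit → (doubleCarriers toyCarriers).Dom → ℂ → (Unit → ℝ) → (Unit → ℂ) → ℂ → ℂ :=
  fun k s _ _ _ _ t _ _ τ => tClamp (1 / 16) t * (gClamp γ (s k) : ℂ) * (τ + τ ^ 2 / 2)

/-- The size of the toy curve: `‖wCurve … τ‖ ≤ (1∕16)·γ·‖τ + τ²∕2‖` (γ ≥ 0). [folklore] -/
theorem norm_wCurve_le {γ : ℝ} (hγ0 : 0 ≤ γ) (k : ℕ) (s : ℕ → ℝ) (y a b : Unit) (x : (doubleCarriers toyCarriers).Dom)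
    (t : ℂ) (s' : Unit → ℝ) (σ' : Unit → ℂ) (τ : ℂ) :
    ‖wCurve γ k s y a b x t s' σ' τ‖ ≤ 1 / 16 * γ * ‖τ + τ ^ 2 / 2‖ := by
  show ‖tClamp (1 / 16) t * (gClamp γ (s k) : ℂ) * (τ + τ ^ 2 / 2)‖ ≤ _
  rw [norm_mul, norm_mul, Complex.norm_real, Real.norm_eq_abs]
  exact mul_le_mul_of_nonneg_right
    (mul_le_mul (norm_tClamp_le (by norm_num) t) (abs_gClamp_le hγ0 _) (abs_nonneg _) (by norm_num)) (norm_nonneg _)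

/-- The toy curve is entire in the slice variable. [folklore] -/
theorem differentiable_wCurve (γ : ℝ) (k : ℕ) (s : ℕ → ℝ) (y a b : Unit) (x : (doubleCarriers toyCarriers).Dom) (t : ℂ)
    (s' : Unit → ℝ) (σ' : Unit → ℂ) : Differentiable ℂ (wCurve γ k s y a b x t s' σ') := by
  show Differentiable ℂ fun τ : ℂ => tClamp (1 / 16) t * (gClamp γ (s k) : ℂ) * (τ + τ ^ 2 / 2)
  exact (differentiable_const _).mul (differentiable_id.add ((differentiable_id.pow 2).div_const 2))

/-- The toy curve family is jointly continuous in `(t, s′, σ′, τ)` (indeed everywhere). [folklore] -/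
theorem continuous_wCurve_uncurry (γ : ℝ) (k : ℕ) (s : ℕ → ℝ) (y a b : Unit) (x : (doubleCarriers toyCarriers).Dom) :
    Continuous fun q : (ℂ × ((Unit → ℝ) × (Unit → ℂ))) × ℂ => wCurve γ k s y a b x q.1.1 q.1.2.1 q.1.2.2 q.2 := by
  show Continuous fun q : (ℂ × ((Unit → ℝ) × (Unit → ℂ))) × ℂ =>
    tClamp (1 / 16) q.1.1 * (gClamp γ (s k) : ℂ) * (q.2 + q.2 ^ 2 / 2)
  exact (((continuous_tClamp (by norm_num)).comp (continuous_fst.comp continuous_fst)).mul continuous_const).mul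
    (continuous_snd.add ((continuous_snd.pow 2).div_const 2))

/-- **THE TOY CURVE IS GENUINELY NON-LINEAR IN THE SLICE VARIABLE**: at the contour point `t = 1∕16` and a history with `s k = γ`
(`0 < γ ≤ γ`, the window edge) there is NO vector `A` with `wCurve … τ = τ • A` for all τ (compare τ = 1 and τ = 2). [folklore] -/
theorem wCurve_not_linear {γ : ℝ} (hγ : 0 < γ) (k : ℕ) (y a b : Unit) (x : (doubleCarriers toyCarriers).Dom) (s' : Unit → ℝ)
    (σ' : Unit → ℂ) : ¬ ∃ A : ℂ, ∀ τ : ℂ, wCurve γ k (fun _ => γ) y a b x ((1 / 16 : ℝ) : ℂ) s' σ' τ = τ • A := by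
  rintro ⟨A, hA⟩
  have ht : (((1 / 16 : ℝ) : ℂ)) ∈ sphere (0:ℂ) (1 / 16) := by
    rw [mem_sphere_zero_iff_norm, Complex.norm_real, Real.norm_eq_abs, abs_of_pos (by norm_num)]
  have hc : tClamp (1 / 16) (((1 / 16 : ℝ) : ℂ)) * (gClamp γ γ : ℂ) = (((1 / 16 : ℝ) : ℂ)) * (γ : ℂ) := by
    rw [tClamp_of_mem_sphere (by norm_num) ht, gClamp_of_window hγ le_rfl]
  have e1 : (((1 / 16 : ℝ) : ℂ)) * (γ : ℂ) * (1 + 1 ^ 2 / 2) = (1:ℂ) • A := by rw [← hA 1, ← hc]; rfl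
  have e2 : (((1 / 16 : ℝ) : ℂ)) * (γ : ℂ) * (2 + 2 ^ 2 / 2) = (2:ℂ) • A := by rw [← hA 2, ← hc]; rfl
  rw [smul_eq_mul] at e1 e2
  have hγC : (γ : ℂ) = 0 := by
    have h16 : (((1 / 16 : ℝ) : ℂ)) * (γ : ℂ) = 0 := by linear_combination e2 - 2 * e1
    simpa using h16
  exact hγ.ne' (Complex.ofReal_eq_zero.1 hγC)

/-! ## §2 The toy curve datum; the binders -/

/-- THE TOY CURVE DATUM (labelled toy): REM-WITNESS's index frame (one box, one domain, one cube, the two sources of the current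
step), `d_k(Y) ≡ 0`, `κ₁ = 1`, `r_k = 1∕16`, `R ≡ 1`, slice curves `wCurve γ`, slice radius `ϱ ≡ 4`. [folklore] -/
def wCur (γ : ℝ) : CurData toyCarriers ℂ Unit Unit Unit Unit Unit where
  S0 := fun _ _ => {()}
  SY := fun _ _ _ => {()}
  src := fun k _ _ j => if j = k then srcPair k else ∅
  Sq := fun k _ _ j => if j = k then {()} else ∅
  SX := fun k _ _ j _ => if j = k then srcPair k else ∅
  dY := fun _ _ => 0
  κ₁ := 1
  r := fun _ => 1 / 16
  cubes := fun _ _ _ _ => [()]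
  cur := wCurve γ
  R := fun _ => 1
  ϱ := fun _ _ _ _ _ _ => 4

/-- **`CurData.Admissible` FOR THE TOY** with `ℓ ≡ 1`, `c_dir = 1∕4`, `d₀ = 0` (all eleven fields), for `0 ≤ γ ≤ 1`: on (indeed
off) the contours the quadratic slice curve is analytic on `|τ| < 4` and maps that disc into the unit ball (`‖·‖ ≤ (γ∕16)·12 < 1`),
`ϱ = 4 > 1`, `ϱ⁻¹ = 1∕4 = c_dir·ℓ`. [folklore] -/
theorem admissible_wCur {γ : ℝ} (hγ0 : 0 ≤ γ) (hγ1 : γ ≤ 1) : (wCur γ).Admissible (fun _ _ => 1) (1 / 4) 0 where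
  κ₁_ge := le_rfl
  r_pos := fun _ => by show (0:ℝ) < 1 / 16; norm_num
  R_pos := fun _ => by show (0:ℝ) < 1; norm_num
  cur_an := by
    intro k s y a b x t _ s' σ' _
    refine ⟨(differentiable_wCurve γ k s y a b x t s' σ').differentiableOn, fun τ hτ => ?_⟩
    have hτ4 : ‖τ‖ < 4 := mem_ball_zero_iff.1 hτ
    rw [mem_ball_zero_iff]
    show ‖wCurve γ k s y a b x t s' σ' τ‖ < 1
    have hq : ‖τ + τ ^ 2 / 2‖ < 12 := by
      have := norm_quad_lt hτ4; norm_num at this; exact this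
    calc ‖wCurve γ k s y a b x t s' σ' τ‖ ≤ 1 / 16 * γ * ‖τ + τ ^ 2 / 2‖ := norm_wCurve_le hγ0 k s y a b x t s' σ' τ
      _ ≤ 1 / 16 * 1 * ‖τ + τ ^ 2 / 2‖ := by gcongr
      _ < 1 := by linarith
  ϱ_gt := fun _ _ _ _ _ _ => by show (1:ℝ) < 4; norm_num
  ϱ_inv_le := fun _ _ _ _ _ _ _ _ _ _ => by show ((4:ℝ))⁻¹ ≤ 1 / 4 * 1; norm_num
  srcScale := by
    intro k y a j x hx
    change x ∈ (if j = k then srcPair k else ∅) at hx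
    split_ifs at hx with h
    · change x.1 = j
      rw [fst_eq_of_mem_srcPair hx, h]
    · simp at hx
  G1 := fun _ _ _ _ _ _ => by show (0:ℝ) ≤ 0 + 4 * (([()] : List Unit).length : ℝ); simp
  d0_nonneg := le_rfl
  cdir_nonneg := by norm_num

/-- **THE LEVEL COUNTS FOR THE TOY CURVE DATUM** (`O1 = 2`, `c_Q = 1`, gain `1`, profile `agePow ω`): the current step carries
one counting cube with the two sources; nothing below the diagonal — REM-WITNESS's `levelCountsG_wRem` verbatim on the same index
frame (the counts never read the curves; re-proved field by field rather than transported, to spare the kernel the unfolding of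
the two piece forms). [folklore] -/
theorem levelCountsG_wCur (γ κ : ℝ) {ω : ℝ} (hω : 0 ≤ ω) :
    LevelCountsG (wCur γ).toC.frame κ (wCur γ).κ₁ 2 1 (fun _ _ => (1:ℝ) ^ 5) (agePow ω) where
  cover := by
    intro k y a j x hx
    change x ∈ (if j = k then srcPair k else ∅) at hx
    refine ⟨(), ?_, ?_⟩
    · change () ∈ (if j = k then ({()} : Finset Unit) else ∅)
      split_ifs with h
      · simp
      · simp [h] at hx
    · change x ∈ (if j = k then srcPair k else ∅)
      exact hx
  sumX := by
    intro k y a j q _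
    change ∑ x ∈ (if j = k then srcPair k else ∅), Real.exp (-(κ * (0:ℝ))) ≤ 2
    split_ifs
    · rw [sum_srcPair_const]
      norm_num
    · simp
  countQ := by
    intro k y a j
    change (((if j = k then ({()} : Finset Unit) else ∅)).card : ℝ) * (1:ℝ) ^ 5 ≤ 1 * agePow ω k j
    split_ifs with h
    · subst h; simp [agePow]
    · simpa using agePow_nonneg hω k j
  sumY := by
    intro k y a _
    change ∑ b ∈ ({()} : Finset Unit), Real.exp (-(1 / 2) * ((1:ℝ) - 1) * (([()] : List Unit).length : ℝ)) ≤ Real.exp 1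
    simp
  count0 := by
    intro k y
    change ((({()} : Finset Unit)).card : ℝ) ≤ Real.exp ((1 / 16) * ((1:ℝ) - 2) * 0)
    simp

/-- THE TOY FAMILY IS IN THE ANALYTIC CLASS of the curve datum (radius 1) — REM-WITNESS's `wE_mem_analyticClass` (same radii).
[folklore] -/
theorem wE_mem_analyticClass_cur (γ : ℝ) (g : ℕ → ℝ) : wE γ g ∈ analyticClass (wCur γ).R :=
  wE_mem_analyticClass γ g

/-- Crew row (w19)'s `hcurA` FOR THE TOY, IN ITS EXACT SHAPE: EVERYWHERE (not only on the contours) the slice curve is analytic on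
its disc `|τ| < ϱ` and maps it into the analyticity ball of its source. [folklore] -/
theorem cur_analytic_wCur {γ : ℝ} (hγ0 : 0 ≤ γ) (hγ1 : γ ≤ 1) :
    ∀ k s y a b x t s' σ', DifferentiableOn ℂ ((wCur γ).cur k s y a b x t s' σ') (ball 0 ((wCur γ).ϱ k s y a b x)) ∧
      MapsTo ((wCur γ).cur k s y a b x t s' σ') (ball 0 ((wCur γ).ϱ k s y a b x)) (ball 0 ((wCur γ).R x.1)) := by
  intro k s y a b x t s' σ'
  refine ⟨(differentiable_wCurve γ k s y a b x t s' σ').differentiableOn, fun τ hτ => ?_⟩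
  have hτ4 : ‖τ‖ < 4 := mem_ball_zero_iff.1 hτ
  rw [mem_ball_zero_iff]
  show ‖wCurve γ k s y a b x t s' σ' τ‖ < 1
  have hq : ‖τ + τ ^ 2 / 2‖ < 12 := by
    have := norm_quad_lt hτ4; norm_num at this; exact this
  calc ‖wCurve γ k s y a b x t s' σ' τ‖ ≤ 1 / 16 * γ * ‖τ + τ ^ 2 / 2‖ := norm_wCurve_le hγ0 k s y a b x t s' σ' τ
    _ ≤ 1 / 16 * 1 * ‖τ + τ ^ 2 / 2‖ := by gcongr
    _ < 1 := by linarith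

/-- Crew row (w19)'s `hcurC` FOR THE TOY, IN ITS EXACT SHAPE: the slice-curve family is jointly continuous in `(t, s′, σ′, τ)` on
(everything ×) the unit slice circle. [folklore] -/
theorem cur_jointContinuous_wCur (γ : ℝ) :
    ∀ k s y a b x, ContinuousOn
      (fun q : (ℂ × (Unit → ℝ) × (Unit → ℂ)) × ℂ => (wCur γ).cur k s y a b x q.1.1 q.1.2.1 q.1.2.2 q.2)
        (univ ×ˢ sphere (0:ℂ) 1) :=
  fun k s y a b x => (continuous_wCurve_uncurry γ k s y a b x).continuousOn

/-- Leaf A3's (c1) FOR THE TOY, IN `NE9CurveSpeciesCoupling`'s EXACT SHAPE: joint continuity of the slice-curve family on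
`({|t| = r_k} × contour) × {|τ| = 1}`. [folklore] -/
theorem cur_contourContinuous_wCur (γ : ℝ) :
    ∀ (k : ℕ) (s : ℕ → ℝ) (y a b : Unit) (x : (doubleCarriers toyCarriers).Dom),
      ContinuousOn (fun q : (ℂ × ((Unit → ℝ) × (Unit → ℂ))) × ℂ => (wCur γ).cur k s y a b x q.1.1 q.1.2.1 q.1.2.2 q.2)
        ((sphere (0:ℂ) ((wCur γ).r k) ×ˢ {q | OnContour (wCur γ).κ₁ ((wCur γ).cubes k y a b) q.1 q.2}) ×ˢ
          sphere (0:ℂ) 1) :=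
  fun k s y a b x => (continuous_wCurve_uncurry γ k s y a b x).continuousOn

/-- Leaf A3's (c2) FOR THE TOY, IN `NE9CurveSpeciesCoupling`'s EXACT SHAPE: on the contour `|t| = 1∕16` and the inner disc
`|τ| < (2·c_dir·ℓ)⁻¹ = 2` the slice curves are Lipschitz in the k-th coupling with displacement `≤ clip·(R∕2)·|g k − g′ k| =
¼|g k − g′ k|` (`clip = 1∕2`, `R = 1`): `|τ + τ²∕2| < 4` there and the coupling clamp is 1-Lipschitz. [folklore] -/
theorem cur_couplingLipschitz_wCur (γ : ℝ) (W : Set (ℕ → ℝ)) :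
    ∀ g ∈ W, ∀ g' ∈ W, ∀ (k : ℕ) (y : Unit), ∀ a ∈ (wCur γ).S0 k y, ∀ b ∈ (wCur γ).SY k y a, ∀ (j : ℕ),
      ∀ x ∈ (wCur γ).src k y a j, ∀ t ∈ sphere (0:ℂ) ((wCur γ).r k), ∀ (s' : Unit → ℝ) (σ' : Unit → ℂ),
        OnContour (wCur γ).κ₁ ((wCur γ).cubes k y a b) s' σ' →
          ∀ τ ∈ ball (0:ℂ) (1 / (2 * (1 / 4 * (fun _ _ : ℕ => (1:ℝ)) k j))),
            ‖(wCur γ).cur k g y a b x t s' σ' τ - (wCur γ).cur k g' y a b x t s' σ' τ‖ ≤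
              1 / 2 * ((wCur γ).R x.1 / 2) * |g k - g' k| := by
  intro g _ g' _ k y a _ b _ j x _ t ht s' σ' _ τ hτ
  show ‖tClamp (1 / 16) t * (gClamp γ (g k) : ℂ) * (τ + τ ^ 2 / 2) -
      tClamp (1 / 16) t * (gClamp γ (g' k) : ℂ) * (τ + τ ^ 2 / 2)‖ ≤ 1 / 2 * (1 / 2) * |g k - g' k|
  have ht' : t ∈ sphere (0:ℂ) (1 / 16) := ht
  have hn : ‖t‖ = 1 / 16 := by simpa using ht'
  have hτ2 : ‖τ‖ < 2 := by
    have h := mem_ball_zero_iff.1 hτ; norm_num at h; exact h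
  have hq : ‖τ + τ ^ 2 / 2‖ < 4 := by
    have := norm_quad_lt hτ2; norm_num at this; exact this
  rw [← sub_mul, ← mul_sub, norm_mul, norm_mul, tClamp_of_mem_sphere (by norm_num) ht', hn, ← Complex.ofReal_sub,
    Complex.norm_real, Real.norm_eq_abs]
  have hcl := abs_gClamp_sub_le γ (g k) (g' k)
  have h0 : 0 ≤ |gClamp γ (g k) - gClamp γ (g' k)| := abs_nonneg _
  nlinarith [norm_nonneg (τ + τ ^ 2 / 2), abs_nonneg (g k - g' k)]

/-- Leaf A3's (c3) FOR THE TOY, IN `NE9CurveSpeciesCoupling`'s EXACT SHAPE: ROOM on the inner disc — `‖cur … τ‖ ≤ R∕2` for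
`|τ| < 2` (indeed `≤ 1∕4`; γ ≤ 1). [folklore] -/
theorem cur_room_wCur {γ : ℝ} (hγ0 : 0 ≤ γ) (hγ1 : γ ≤ 1) (W : Set (ℕ → ℝ)) :
    ∀ g ∈ W, ∀ (k : ℕ) (y : Unit), ∀ a ∈ (wCur γ).S0 k y, ∀ b ∈ (wCur γ).SY k y a, ∀ (j : ℕ),
      ∀ x ∈ (wCur γ).src k y a j, ∀ t ∈ sphere (0:ℂ) ((wCur γ).r k), ∀ (s' : Unit → ℝ) (σ' : Unit → ℂ),
        OnContour (wCur γ).κ₁ ((wCur γ).cubes k y a b) s' σ' →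
          ∀ τ ∈ ball (0:ℂ) (1 / (2 * (1 / 4 * (fun _ _ : ℕ => (1:ℝ)) k j))),
            ‖(wCur γ).cur k g y a b x t s' σ' τ‖ ≤ (wCur γ).R x.1 / 2 := by
  intro g _ k y a _ b _ j x _ t _ s' σ' _ τ hτ
  show ‖wCurve γ k g y a b x t s' σ' τ‖ ≤ 1 / 2
  have hτ2 : ‖τ‖ < 2 := by
    have h := mem_ball_zero_iff.1 hτ; norm_num at h; exact h
  have hq : ‖τ + τ ^ 2 / 2‖ < 4 := by
    have := norm_quad_lt hτ2; norm_num at this; exact this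
  calc ‖wCurve γ k g y a b x t s' σ' τ‖ ≤ 1 / 16 * γ * ‖τ + τ ^ 2 / 2‖ := norm_wCurve_le hγ0 k g y a b x t s' σ' τ
    _ ≤ 1 / 16 * 1 * 4 := by gcongr
    _ ≤ 1 / 2 := by norm_num

/-! ## §3 The producers fire on the toy curve datum -/

/-- **S4 ∧ S5 FIRE ON THE TOY CURVE DATUM (kernel)**: the row owner's `NE9Lemma1CurveSpecies.structureBinders_cur` and
`channelSizeAtStepNN_cur` (p213869) APPLIED to `wCur γ` — `ChannelLocal` ∧ `ChannelStepSum` ∧ `ChannelSizeAtStepNN` for the toy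
channel `cpieceChannel (wCur γ).toC` on its analytic class, with the weight `weightOf … 1 0 2 ((wCur γ).Kp (1∕4))` and the profile
`tauOfG 1 (agePow ω)`; every hypothesis (`Admissible`, the counts, the scalars) DISCHARGED by §2.  S3 is (w19)'s `sBinders_cur`
fed with `cur_analytic_wCur` ∕ `cur_jointContinuous_wCur` once it lands — not asserted here. [folklore] -/
theorem sizeBinders_witness_cur {γ : ℝ} (hγ0 : 0 ≤ γ) (hγ1 : γ ≤ 1) (κ : ℝ) {ω : ℝ} (hω : 0 ≤ ω) :
    ChannelLocal (analyticClass (wCur γ).R) (cpieceChannel (wCur γ).toC) ∧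
      ChannelStepSum (analyticClass (wCur γ).R) (cpieceChannel (wCur γ).toC) ∧
      ChannelSizeAtStepNN (analyticClass (wCur γ).R) (cpieceChannel (wCur γ).toC) κ
        (weightOf (wCur γ).toC.frame (wCur γ).κ₁ 0 2 ((wCur γ).Kp (1 / 4))) (tauOfG 1 (agePow ω)) :=
  ⟨(structureBinders_cur (admissible_wCur hγ0 hγ1) _).1, (structureBinders_cur (admissible_wCur hγ0 hγ1) _).2.1,
    channelSizeAtStepNN_cur (admissible_wCur hγ0 hγ1) (fun _ _ => zero_le_one) κ (levelCountsG_wCur γ κ hω) (by norm_num)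
      (fun k j => by simpa using agePow_nonneg hω k j)⟩

/-- **A3-CUR FIRES ON THE TOY CURVE DATUM (kernel)**: leaf-05-g5's `NE9CurveSpeciesCoupling.cpieceResponse_cur` (p214647; engine
leaf-06-g7's `NE9CurveRemainderCoupling` p213961) APPLIED to `wCur γ` ∕ `wE γ` on any window `W`, with `ℓ ≡ 1`, `c_dir = 1∕4`,
`d₀ = 0`, `N ≡ Nbar = γ`, `clip = 1∕2` — every hypothesis (`Admissible`, analyticity, `TermSize`, `hhalf`, (c1)–(c3) and the
scalars) DISCHARGED by §2 and REM-WITNESS's family lemmas: the per-piece coupling response of the toy curve pieces is bounded as the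
producer says, with `qc = 64·½·γ`. [folklore] -/
theorem cpieceResponse_witness_cur {γ : ℝ} (hγ0 : 0 ≤ γ) (hγ1 : γ ≤ 1) (W : Set (ℕ → ℝ)) (κ : ℝ) :
    ∀ g ∈ W, ∀ g' ∈ W, ∀ (k : ℕ) (y : Unit), ∀ a ∈ (wCur γ).toC.S0 k y, ∀ b ∈ (wCur γ).toC.SY k y a, ∀ (j : ℕ),
      ∀ x ∈ (wCur γ).toC.src k y a j,
      |(wCur γ).toC.piece k g y a b x (wE γ g) - (wCur γ).toC.piece k g' y a b x (wE γ g)| ≤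
        (wCur γ).Kp (1 / 4) k y * (64 * (1 / 2) * γ) * (fun _ _ : ℕ => (1:ℝ)) k j ^ 5 *
          Real.exp (-(κ * (doubleCarriers toyCarriers).d x)) *
          Real.exp (-(1 / 8) * ((wCur γ).κ₁ - 1) * (wCur γ).toC.dY k y + (1 / 8) * (wCur γ).κ₁ * 0 -
            (1 / 2) * ((wCur γ).κ₁ - 1) * (wCur γ).toC.vol k y a b) * |g k - g' k| :=
  cpieceResponse_cur (admissible_wCur hγ0 hγ1) (Ef := wE γ) (N := fun _ => γ) (Nbar := γ) (clip := 1 / 2)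
    (fun g _ => wE_mem_analyticClass_cur γ g) (termSize_wE hγ0 W κ) (fun _ => hγ0) (fun _ => le_rfl) (by norm_num)
    (by norm_num) (fun _ _ => one_pos) (fun _ _ => by norm_num) (cur_contourContinuous_wCur γ)
    (cur_couplingLipschitz_wCur γ W) (cur_room_wCur hγ0 hγ1 W)

/-- **THE END's `hTcup` CLAUSE FIRES ON THE TOY CURVE DATUM (kernel)**: leaf-05-g5's `channelCouplingModulus_cur` APPLIED — for the
toy channel `T := cpieceChannel (wCur γ).toC` read at the family `wE γ` on any window, `|T k g (E g) y − T k g′ (E g) y| ≤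
wt k y · (qT·|g k − g′ k|)` with the S5 weight of `sizeBinders_witness_cur` and the EXPLICIT k-uniform constant
`qT = 64·½·γ·1·(1 − ω)⁻¹` (`0 ≤ ω < 1`). [folklore] -/
theorem tcup_witness_cur {γ : ℝ} (hγ0 : 0 ≤ γ) (hγ1 : γ ≤ 1) (W : Set (ℕ → ℝ)) (κ : ℝ) {ω : ℝ} (hω0 : 0 ≤ ω)
    (hω1 : ω < 1) :
    ∀ g ∈ W, ∀ g' ∈ W, ∀ (k : ℕ) (y : Unit),
      |cpieceChannel (wCur γ).toC k g (wE γ g) y - cpieceChannel (wCur γ).toC k g' (wE γ g) y| ≤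
        weightOf (wCur γ).toC.frame (wCur γ).κ₁ 0 2 ((wCur γ).Kp (1 / 4)) k y *
          (64 * (1 / 2) * γ * 1 * (1 - ω)⁻¹ * |g k - g' k|) :=
  channelCouplingModulus_cur (admissible_wCur hγ0 hγ1) (Ef := wE γ) (N := fun _ => γ) (Nbar := γ) (clip := 1 / 2)
    (fun g _ => wE_mem_analyticClass_cur γ g) (termSize_wE hγ0 W κ) (fun _ => hγ0) (fun _ => le_rfl) (by norm_num)
    (by norm_num) (fun _ _ => one_pos) (fun _ _ => by norm_num) (cur_contourContinuous_wCur γ)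
    (cur_couplingLipschitz_wCur γ W) (cur_room_wCur hγ0 hγ1 W) (levelCountsG_wCur γ κ hω0) (by norm_num) zero_le_one hω0 hω1

/-! ## §4 The toy curve datum is NOT the curve reading of any ray datum -/

/-- **NOT A RAY (kernel)**: for `0 < γ` the toy curve datum is not `RemData.toCur Dd` for ANY ray datum `Dd` — the curve reading
of a ray datum has slice curves `τ ↦ τ • dir …`, linear in τ, whereas `wCurve γ` at `t = 1∕16`, `s k = γ` is not
(`wCurve_not_linear`).  So this inhabitant of `CurData.Admissible` lies OUTSIDE the ray sub-case that all earlier witnesses and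
END instances inhabit. [folklore] -/
theorem toCur_ne_wCur {γ : ℝ} (hγ : 0 < γ) (Dd : RemData toyCarriers ℂ Unit Unit Unit Unit Unit) : Dd.toCur ≠ wCur γ := by
  intro h
  refine wCurve_not_linear hγ 0 () () () ((0 : ℕ), true) (fun _ => 0) (fun _ => 1)
    ⟨Dd.dir 0 (fun _ => γ) () () () ((0 : ℕ), true) (((1 / 16 : ℝ) : ℂ)) (fun _ => 0) (fun _ => 1), fun τ => ?_⟩
  have hcur := congrArg
    (fun D : CurData toyCarriers ℂ Unit Unit Unit Unit Unit =>
      D.cur 0 (fun _ => γ) () () () ((0 : ℕ), true) (((1 / 16 : ℝ) : ℂ)) (fun _ => 0) (fun _ => 1) τ) h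
  exact hcur.symm

end Summit.QuantumFields.BalabanUV.T4Continuum.NE9CurveSpeciesWitness

end
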